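import Literature.NumberTheory.ModularSymbols.FullLevelHomologyCarrier
import Literature.Algebra.Homology.GroupHomologyPermutationModuleShapiro
import HarnessLib

/-!
# `Γ_T ≅ Γ₀(p²M)` by `diag(p, 1)`-conjugation, and the up/down dictionary
# `H₁(Y(K(p)K₀(M)), k)^{T̃} ≃ H₁(Γ_T, k) ≃ H₁(Γ₀(p²M), k)` (step (S2) of the composed K-line)

Topic `Literature/NumberTheory/ModularSymbols`; namespace `Literature.NumberTheory.ModularSymbols.FullLevel`; sequel of
`FullLevelHomologyCarrier` (`redGL`, `coeff`, `H1carrier`, `H1carrierRep`, `principalLevel`, `diagTorus`,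
`torusLevel`, `redGL_smul_one_surjective`) over the generic `Algebra/Homology/GroupHomologyPermutationModule*`
files (stabilizer symbols, degree-one Shapiro `componentEquiv`, averaging `invariantsEquivQuot`).
Definitions with bodies + proved theorems; no named fact, no `sorry`, no instance, no notation.

* `symbol k p M γ x a = [γ ⊗ aδ_x]` (`γ ∈ Γ(p) ∩ Γ₀(M)`), **`span_symbol_eq_top`** (they span the carrier),
  `H1carrierRep_symbol` (`g · [γ ⊗ aδ_x] = [γ ⊗ aδ_{xg⁻¹}]`).
* `conjDown p A = δ⁻¹Aδ = (a, b/p; pc, d)`, `conjUp p A = δAδ⁻¹` (`δ = diag(p,1)`), determinant / inverse /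
  multiplicativity lemmas, and **`torusLevelEquiv p M hpM : Γ_T ≃* Γ₀(p²M)`** for `gcd(p, M) = 1`
  (`Γ_T = {γ ∈ Γ₀(M) : p ∣ b, p ∣ c} = δ Γ₀(p²M) δ⁻¹`; Diamond–Shurman §1.5).
* **`torusInvariantsEquiv`**: `H₁(Γ₀(M), k[GL₂(ℤ/p)])^{T̃} ≃ₗ[k] H₁(Γ_T, k)` for `gcd(p,M) = 1` and `|T̃| ∈ kˣ`
  (averaging iso ∘ Shapiro⁻¹ at the coset `T̃`); `torusLevelH1Iso`: `H₁(Γ_T, k) ≅ H₁(Γ₀(p²M), k)`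
  (Mathlib `groupHomology.mapIso` along `torusLevelEquiv`); their composite
  **`torusInvariantsEquivGamma0 : H₁(Γ₀(M), k[GL₂(ℤ/p)])^{T̃} ≃ₗ[k] H₁(Γ₀(p²M), k)`** — the dictionary
  «`X₀(p²M) = Y(K(p)K₀(M))/T̃`, `H₁(X₀(p²M), ℤ_p)_𝔪 = Λ′^{T̃}`» of the K-line audit (S2) (route
  BSD/TeichmullerTwistDescent, crux `TwistedPeriodLatticeSaturation`), at the level of the open curves / group
  homology; the passage to `periodHomology (p²M)` (Manin symbols, Eisenstein classes) is NOT here.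
  The instances `[Fintype T̃] [Invertible (|T̃| : k)]` are hypotheses (`|T̃| = (p−1)²`, a unit of `ℤ_p`).

## References
* F. Diamond, J. Shurman, *A First Course in Modular Forms* (2005), §1.5 (conjugate congruence subgroups;
  `Γ₀(p²M)` vs `Γ₀(pM) ∩ Γ⁰(p)`), Exercise 1.5.6. [DiamondShurman2005]
* A. Ash, G. Stevens, Duke Math. J. 53 (1986), §1 (1.2)–(1.3). [AshStevens1986]
* K. S. Brown, *Cohomology of Groups* (1982), Ch. III §6 Prop. 6.2, (6.5). [Brown1982]
-/

noncomputable section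

namespace Literature.NumberTheory.ModularSymbols

namespace FullLevel

open scoped MatrixGroups
open CategoryTheory CongruenceSubgroup groupHomology Finsupp Matrix
open Literature.Algebra.Homology

section Conj

variable (p M : ℕ)

/-! ### `Γ_T ≅ Γ₀(p²M)` by conjugation with `δ = diag(p, 1)` -/

/-- `δ⁻¹ A δ` for `δ = diag(p, 1)`: `(a b; c d) ↦ (a, b/p; pc, d)` (integral when `p ∣ b`).
[cite: DiamondShurman2005, §1.5 (conjugation of congruence subgroups), Exercise 1.5.6] -/
def conjDown (A : Matrix (Fin 2) (Fin 2) ℤ) : Matrix (Fin 2) (Fin 2) ℤ :=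
  !![A 0 0, A 0 1 / p; A 1 0 * p, A 1 1]

/-- `δ A δ⁻¹`: `(a b; c d) ↦ (a, pb; c/p, d)` (integral when `p ∣ c`). [cite: DiamondShurman2005, §1.5] -/
def conjUp (A : Matrix (Fin 2) (Fin 2) ℤ) : Matrix (Fin 2) (Fin 2) ℤ :=
  !![A 0 0, A 0 1 * p; A 1 0 / p, A 1 1]

variable {p}

/-- `det (δ⁻¹ A δ) = det A`. [cite: DiamondShurman2005, §1.5] -/
theorem det_conjDown (A : Matrix (Fin 2) (Fin 2) ℤ) (h : (p : ℤ) ∣ A 0 1) : (conjDown p A).det = A.det := by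
  rw [conjDown, Matrix.det_fin_two_of, Matrix.det_fin_two]
  obtain ⟨b, hb⟩ := h
  rcases eq_or_ne (p : ℤ) 0 with hp | hp
  · rw [hb, hp]; simp
  · rw [hb, Int.mul_ediv_cancel_left _ hp]; ring

/-- `det (δ A δ⁻¹) = det A`. [cite: DiamondShurman2005, §1.5] -/
theorem det_conjUp (A : Matrix (Fin 2) (Fin 2) ℤ) (h : (p : ℤ) ∣ A 1 0) : (conjUp p A).det = A.det := by
  rw [conjUp, Matrix.det_fin_two_of, Matrix.det_fin_two]
  obtain ⟨c, hc⟩ := h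
  rcases eq_or_ne (p : ℤ) 0 with hp | hp
  · rw [hc, hp]; simp
  · rw [hc, Int.mul_ediv_cancel_left _ hp]; ring

/-- `δ (δ⁻¹ A δ) δ⁻¹ = A`. [cite: DiamondShurman2005, §1.5] -/
theorem conjUp_conjDown (hp : (p : ℤ) ≠ 0) (A : Matrix (Fin 2) (Fin 2) ℤ) (h : (p : ℤ) ∣ A 0 1) :
    conjUp p (conjDown p A) = A := by
  ext i j
  fin_cases i <;> fin_cases j <;>
    simp [conjUp, conjDown, Int.ediv_mul_cancel h, Int.mul_ediv_cancel _ hp]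

/-- `δ⁻¹ (δ A δ⁻¹) δ = A`. [cite: DiamondShurman2005, §1.5] -/
theorem conjDown_conjUp (hp : (p : ℤ) ≠ 0) (A : Matrix (Fin 2) (Fin 2) ℤ) (h : (p : ℤ) ∣ A 1 0) :
    conjDown p (conjUp p A) = A := by
  ext i j
  fin_cases i <;> fin_cases j <;>
    simp [conjUp, conjDown, Int.ediv_mul_cancel h, Int.mul_ediv_cancel _ hp]

/-- `δ⁻¹ (A B) δ = (δ⁻¹ A δ)(δ⁻¹ B δ)`. [cite: DiamondShurman2005, §1.5] -/
theorem conjDown_mul (hp : (p : ℤ) ≠ 0) (A B : Matrix (Fin 2) (Fin 2) ℤ) (hA : (p : ℤ) ∣ A 0 1)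
    (hB : (p : ℤ) ∣ B 0 1) : conjDown p (A * B) = conjDown p A * conjDown p B := by
  obtain ⟨a, ha⟩ := hA
  obtain ⟨b, hb⟩ := hB
  have e1 : A 0 1 / p = a := by rw [ha, Int.mul_ediv_cancel_left _ hp]
  have e2 : B 0 1 / p = b := by rw [hb, Int.mul_ediv_cancel_left _ hp]
  have e3 : (A 0 0 * B 0 1 + A 0 1 * B 1 1) / p = A 0 0 * b + a * B 1 1 := by
    rw [ha, hb, show A 0 0 * (p * b) + p * a * B 1 1 = p * (A 0 0 * b + a * B 1 1) by ring,
      Int.mul_ediv_cancel_left _ hp]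
  ext i j
  fin_cases i <;> fin_cases j <;>
    simp [conjDown, Matrix.mul_apply, Fin.sum_univ_two, e1, e2, e3] <;>
    (try rw [ha]) <;> (try rw [hb]) <;> ring

variable (p)
variable [Fact p.Prime]

/-- For `γ ∈ Γ_T`: `p ∣ b`. [cite: DiamondShurman2005, §1.5] -/
theorem dvd_entry01_of_mem_torusLevel {γ : Gamma0 M} (h : γ ∈ torusLevel p M) :
    (p : ℤ) ∣ ((γ : SL(2, ℤ)) : Matrix (Fin 2) (Fin 2) ℤ) 0 1 :=
  (ZMod.intCast_zmod_eq_zero_iff_dvd _ p).1 ((mem_torusLevel_iff p M γ).1 h).1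

/-- For `γ ∈ Γ_T`: `p ∣ c`. [cite: DiamondShurman2005, §1.5] -/
theorem dvd_entry10_of_mem_torusLevel {γ : Gamma0 M} (h : γ ∈ torusLevel p M) :
    (p : ℤ) ∣ ((γ : SL(2, ℤ)) : Matrix (Fin 2) (Fin 2) ℤ) 1 0 :=
  (ZMod.intCast_zmod_eq_zero_iff_dvd _ p).1 ((mem_torusLevel_iff p M γ).1 h).2

/-- For `γ ∈ Γ₀(M)`: `M ∣ c`. [cite: DiamondShurman2005, §1.2] -/
theorem dvd_entry10_of_gamma0 (γ : Gamma0 M) : (M : ℤ) ∣ ((γ : SL(2, ℤ)) : Matrix (Fin 2) (Fin 2) ℤ) 1 0 :=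
  (ZMod.intCast_zmod_eq_zero_iff_dvd _ M).1 (Gamma0_mem.1 γ.2)

/-- `δ⁻¹ γ δ ∈ SL₂(ℤ)` for `γ ∈ Γ_T`. [cite: DiamondShurman2005, §1.5] -/
def conjDownSL (γ : torusLevel p M) : SL(2, ℤ) :=
  ⟨conjDown p ((γ.1 : SL(2, ℤ)) : Matrix (Fin 2) (Fin 2) ℤ), by
    rw [det_conjDown _ (dvd_entry01_of_mem_torusLevel p M γ.2), Matrix.SpecialLinearGroup.det_coe]⟩

/-- `δ⁻¹ γ δ ∈ Γ₀(p²M)` for `γ ∈ Γ_T` (`gcd(p, M) = 1`: `p ∣ c`, `M ∣ c` ⇒ `pM ∣ c` ⇒ `p²M ∣ pc`).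
[cite: DiamondShurman2005, §1.5] -/
theorem conjDownSL_mem (hpM : Nat.Coprime p M) (γ : torusLevel p M) : conjDownSL p M γ ∈ Gamma0 (p ^ 2 * M) := by
  rw [Gamma0_mem]
  show ((conjDown p ((γ.1 : SL(2, ℤ)) : Matrix (Fin 2) (Fin 2) ℤ) 1 0 : ℤ) : ZMod (p ^ 2 * M)) = 0
  rw [ZMod.intCast_zmod_eq_zero_iff_dvd]
  simp only [conjDown, Matrix.of_apply, Matrix.cons_val', Matrix.cons_val_zero, Matrix.cons_val_one,
    Matrix.cons_val_fin_one]
  have hc : ((p : ℤ) * M) ∣ ((γ.1 : SL(2, ℤ)) : Matrix (Fin 2) (Fin 2) ℤ) 1 0 :=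
    (Int.isCoprime_iff_gcd_eq_one.2 (by simpa using hpM)).mul_dvd
      (dvd_entry10_of_mem_torusLevel p M γ.2) (dvd_entry10_of_gamma0 M γ.1)
  obtain ⟨q, hq⟩ := hc
  refine ⟨q, ?_⟩
  rw [hq]; push_cast; ring

/-- `δ γ' δ⁻¹ ∈ SL₂(ℤ)` for `γ' ∈ Γ₀(p²M)`. [cite: DiamondShurman2005, §1.5] -/
def conjUpSL (γ : Gamma0 (p ^ 2 * M)) : SL(2, ℤ) :=
  ⟨conjUp p ((γ : SL(2, ℤ)) : Matrix (Fin 2) (Fin 2) ℤ), by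
    rw [det_conjUp _ ((dvd_mul_right (p : ℤ) (p * M)).trans
      (by simpa [pow_two, mul_assoc] using dvd_entry10_of_gamma0 (p ^ 2 * M) γ)),
      Matrix.SpecialLinearGroup.det_coe]⟩

/-- `δ γ' δ⁻¹ ∈ Γ₀(M)` for `γ' ∈ Γ₀(p²M)`. [cite: DiamondShurman2005, §1.5] -/
theorem conjUpSL_mem_gamma0 (γ : Gamma0 (p ^ 2 * M)) : conjUpSL p M γ ∈ Gamma0 M := by
  rw [Gamma0_mem]
  show ((conjUp p ((γ : SL(2, ℤ)) : Matrix (Fin 2) (Fin 2) ℤ) 1 0 : ℤ) : ZMod M) = 0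
  rw [ZMod.intCast_zmod_eq_zero_iff_dvd]
  simp only [conjUp, Matrix.of_apply, Matrix.cons_val', Matrix.cons_val_zero, Matrix.cons_val_one,
    Matrix.cons_val_fin_one]
  obtain ⟨q, hq⟩ := dvd_entry10_of_gamma0 (p ^ 2 * M) γ
  have hp : (p : ℤ) ≠ 0 := by exact_mod_cast (Fact.out : p.Prime).ne_zero
  refine ⟨p * q, ?_⟩
  rw [hq]; push_cast
  rw [show (p : ℤ) ^ 2 * M * q = p * (M * (p * q)) by ring, Int.mul_ediv_cancel_left _ hp]

/-- `δ γ' δ⁻¹ ∈ Γ_T` for `γ' ∈ Γ₀(p²M)`. [cite: DiamondShurman2005, §1.5] -/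
theorem conjUpSL_mem_torusLevel (γ : Gamma0 (p ^ 2 * M)) :
    (⟨conjUpSL p M γ, conjUpSL_mem_gamma0 p M γ⟩ : Gamma0 M) ∈ torusLevel p M := by
  rw [mem_torusLevel_iff]
  show ((conjUp p ((γ : SL(2, ℤ)) : Matrix (Fin 2) (Fin 2) ℤ) 0 1 : ℤ) : ZMod p) = 0 ∧
    ((conjUp p ((γ : SL(2, ℤ)) : Matrix (Fin 2) (Fin 2) ℤ) 1 0 : ℤ) : ZMod p) = 0
  rw [ZMod.intCast_zmod_eq_zero_iff_dvd, ZMod.intCast_zmod_eq_zero_iff_dvd]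
  simp only [conjUp, Matrix.of_apply, Matrix.cons_val', Matrix.cons_val_zero, Matrix.cons_val_one,
    Matrix.cons_val_fin_one]
  refine ⟨dvd_mul_left _ _, ?_⟩
  obtain ⟨q, hq⟩ := dvd_entry10_of_gamma0 (p ^ 2 * M) γ
  have hp : (p : ℤ) ≠ 0 := by exact_mod_cast (Fact.out : p.Prime).ne_zero
  refine ⟨M * q, ?_⟩
  rw [hq]; push_cast
  rw [show (p : ℤ) ^ 2 * M * q = p * (p * (M * q)) by ring, Int.mul_ediv_cancel_left _ hp]

/-- **`Γ_T ≅ Γ₀(p²M)`**, `γ ↦ δ⁻¹ γ δ` with `δ = diag(p, 1)` (`gcd(p, M) = 1`): the up/down dictionary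
`X₀(p²M) = Y(K(p)K₀(M))/T̃` at the level of fundamental groups. [cite: DiamondShurman2005, §1.5 and Exercise 1.5.6] -/
def torusLevelEquiv (hpM : Nat.Coprime p M) : torusLevel p M ≃* Gamma0 (p ^ 2 * M) where
  toFun γ := ⟨conjDownSL p M γ, conjDownSL_mem p M hpM γ⟩
  invFun γ := ⟨⟨conjUpSL p M γ, conjUpSL_mem_gamma0 p M γ⟩, conjUpSL_mem_torusLevel p M γ⟩
  left_inv γ := by
    apply Subtype.ext; apply Subtype.ext; apply Subtype.ext
    exact conjUp_conjDown (by exact_mod_cast (Fact.out : p.Prime).ne_zero) _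
      (dvd_entry01_of_mem_torusLevel p M γ.2)
  right_inv γ := by
    apply Subtype.ext; apply Subtype.ext
    exact conjDown_conjUp (by exact_mod_cast (Fact.out : p.Prime).ne_zero) _
      ((dvd_mul_right (p : ℤ) (p * M)).trans
        (by simpa [pow_two, mul_assoc] using dvd_entry10_of_gamma0 (p ^ 2 * M) γ))
  map_mul' γ γ' := by
    apply Subtype.ext; apply Subtype.ext
    exact conjDown_mul (by exact_mod_cast (Fact.out : p.Prime).ne_zero) _ _
      (dvd_entry01_of_mem_torusLevel p M γ.2) (dvd_entry01_of_mem_torusLevel p M γ'.2)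

/-- Entries of `torusLevelEquiv γ = δ⁻¹ γ δ`. [cite: DiamondShurman2005, §1.5] -/
theorem coe_torusLevelEquiv (hpM : Nat.Coprime p M) (γ : torusLevel p M) :
    (((torusLevelEquiv p M hpM γ : Gamma0 (p ^ 2 * M)) : SL(2, ℤ)) : Matrix (Fin 2) (Fin 2) ℤ) =
      conjDown p ((γ.1 : SL(2, ℤ)) : Matrix (Fin 2) (Fin 2) ℤ) := rfl

end Conj

section Dictionary

variable (k : Type) [CommRing k] (p M : ℕ)

/-! ### The symbols: generators of the carrier and their behaviour under the dictionary -/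

/-- The **full-level symbol** `[γ ⊗ aδ_x] ∈ H₁(Γ₀(M), k[GL₂(ℤ/p)])` of `γ ∈ Γ(p) ∩ Γ₀(M)` at the point
`x ∈ GL₂(ℤ/p)` (a loop in the component/sheet through `x`). [cite: AshStevens1986, §1 (1.3)] -/
def symbol (γ : principalLevel p M) (x : GL (Fin 2) (ZMod p)) (a : k) : H1carrier k p M :=
  PermutationCoeff.stabSymbol k (redGL p M) x ⟨γ.1, (stabilizerIn_eq_principalLevel p M x).symm ▸ γ.2⟩ a

/-- The full-level symbols span the carrier. [cite: AshStevens1986, §1 (1.3); Brown1982, Ch. III §6 (6.5)] -/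
theorem span_symbol_eq_top :
    Submodule.span k {w : H1carrier k p M | ∃ (γ : principalLevel p M) (x : GL (Fin 2) (ZMod p)) (a : k),
      w = symbol k p M γ x a} = ⊤ := by
  have h := PermutationCoeff.symbolSpan_univ_eq_top (k := k) (redGL p M) (X := GL (Fin 2) (ZMod p))
  rw [PermutationCoeff.symbolSpan] at h
  rw [eq_top_iff, ← h]
  refine Submodule.span_mono ?_
  rintro _ ⟨x, -, γ, a, rfl⟩
  exact ⟨⟨γ.1, (stabilizerIn_eq_principalLevel p M x) ▸ γ.2⟩, x, a, rfl⟩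

/-- The `GL₂(ℤ/p)`-action permutes the symbols: `g · [γ ⊗ aδ_x] = [γ ⊗ aδ_{xg⁻¹}]`.
[cite: AshStevens1986, §1 (1.2)] -/
theorem H1carrierRep_symbol (g : GL (Fin 2) (ZMod p)) (γ : principalLevel p M) (x : GL (Fin 2) (ZMod p))
    (a : k) : H1carrierRep k p M g (symbol k p M γ x a) = symbol k p M γ (x * g⁻¹) a :=
  PermutationCoeff.H1RightRep_stabSymbol (redGL p M) g x _ a


section Torus

variable [Fact p.Prime]

/-! ### The up/down dictionary (S2): `H₁(Y(K(p)K₀(M)), k)^{T̃} ≃ H₁(Γ_T, k) ≃ H₁(Γ₀(p²M), k)` -/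

/-- **(S2), first half: torus invariants ↔ the torus level.** For `gcd(p, M) = 1` and `|T̃| ∈ kˣ`:
`H₁(Γ₀(M), k[GL₂(ℤ/p)])^{T̃} ≃ₗ[k] H₁(Γ_T, k)`, the composite of the averaging isomorphism
(`PermutationCoeff.invariantsEquivQuot`, torus invariants `≅ H₁(Γ₀(M), k[G/T̃])`) with the inverse of the
degree-one Shapiro isomorphism (`PermutationCoeff.componentEquiv` at the coset `T̃`, using transitivity
`redGL_smul_one_surjective`; `Γ_T` = the stabilizer of that coset by definition).
[cite: AshStevens1986, §1 (1.2)–(1.3); Brown1982, Ch. III §6 Prop. 6.2] -/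
def torusInvariantsEquiv (hpM : Nat.Coprime p M) [Fintype (diagTorus (ZMod p))]
    [Invertible (Fintype.card (diagTorus (ZMod p)) : k)] :
    PermutationCoeff.H1Invariants k (redGL p M) (diagTorus (ZMod p)) ≃ₗ[k]
      groupHomology.H1 (Rep.trivial k (torusLevel p M) k) :=
  (PermutationCoeff.invariantsEquivQuot (redGL p M) (diagTorus (ZMod p))).trans
    (PermutationCoeff.componentEquiv (redGL p M)
      ((1 : GL (Fin 2) (ZMod p)) : GL (Fin 2) (ZMod p) ⧸ diagTorus (ZMod p))
      (redGL_smul_one_surjective p M hpM)).symm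

/-- **(S2), second half: `H₁(Γ_T, k) ≅ H₁(Γ₀(p²M), k)`** along `Γ_T ≅ Γ₀(p²M)` (`torusLevelEquiv`, conjugation
by `diag(p, 1)`), trivial coefficients. [cite: DiamondShurman2005, §1.5; Brown1982, Ch. III §6] -/
def torusLevelH1Iso (hpM : Nat.Coprime p M) :
    groupHomology.H1 (Rep.trivial k (torusLevel p M) k) ≅
      groupHomology.H1 (Rep.trivial k (Gamma0 (p ^ 2 * M)) k) :=
  groupHomology.mapIso (A := Rep.trivial k (torusLevel p M) k) (B := Rep.trivial k (Gamma0 (p ^ 2 * M)) k)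
    (torusLevelEquiv p M hpM) (LinearEquiv.refl k k) (fun g => by ext; simp) 1

/-- **The up/down dictionary (S2) as one `k`-linear equivalence**
`H₁(Γ₀(M), k[GL₂(ℤ/p)])^{T̃} ≃ₗ[k] H₁(Γ₀(p²M), k)` (`gcd(p, M) = 1`, `|T̃| ∈ kˣ`; e.g. `k = ℤ_p`, `|T̃| = (p−1)²`).
In the K-line of route BSD/TeichmullerTwistDescent this is «`H₁(X₀(p²M), ℤ_p) = Λ′^{T̃}`» (audit (S2)), up to the
Eisenstein classes killed downstream by the period map. [cite: AshStevens1986, §1 (1.2)–(1.3)] -/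
def torusInvariantsEquivGamma0 (hpM : Nat.Coprime p M) [Fintype (diagTorus (ZMod p))]
    [Invertible (Fintype.card (diagTorus (ZMod p)) : k)] :
    PermutationCoeff.H1Invariants k (redGL p M) (diagTorus (ZMod p)) ≃ₗ[k]
      groupHomology.H1 (Rep.trivial k (Gamma0 (p ^ 2 * M)) k) :=
  (torusInvariantsEquiv k p M hpM).trans (torusLevelH1Iso k p M hpM).toLinearEquiv

end Torus

end Dictionary

end FullLevel

end Literature.NumberTheory.ModularSymbols
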